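import Summits.KontsevichZagierPeriods.KontsevichZagierPeriods.Theorems.GammaHodgeSector.Negative.LoadBearing
import Summits.KontsevichZagierPeriods.KontsevichZagierPeriods.Theorems.GammaHodgeSector.Negative.Fermat33
import Summits.KontsevichZagierPeriods.KontsevichZagierPeriods.Theorems.GammaHodgeSector.Negative.Symbol33
import Summits.KontsevichZagierPeriods.KontsevichZagierPeriods.Theorems.TerasomaMultiplicationGammaHodgeSectorAfterMultiplication
import Summits.KontsevichZagierPeriods.KontsevichZagierPeriods.Theorems.TerasomaMultiplicationGammaHodgeSectorTorsionKilling
import Summits.KontsevichZagierPeriods.KontsevichZagierPeriods.Theorems.TerasomaMultiplicationGammaHodgeFromRelators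
import Literature.NumberTheory.Transcendental.KZKernelConjectureForms

/-!
# Strategist r1 certificate — crux stmt-KontsevichZagierPeriods-3742 `GammaHodgeSector`
(route `TerasomaMultiplication`; decl shared verbatim with `MotivatedMoves`)

Companion to `Cruxes/GammaHodgeSector/STRATEGY-CENSUS.md` (redirect strategist r1, 2026-08-17).
Everything below is a ONE-LINE consequence of LANDED theorems of the tree (no new mathematics, no
definitions, no `sorry`); it fixes, by name, the kernel-checked facts the census argues from:

* §1 PROBES. `S → C` is a theorem (`summit_implies_crux`); `¬C → ¬S` (`no_cheap_kill`). The converse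
  `C → S` is NOT in the tree: the BC2 probe files of the strategist folder
  (`bc/GammaHodgeSector_probe_CtoS.lean`: `first | exact? | simpa [C] | (unfold C; simpa) | aesop`,
  rc 1, deterministic timeout = no closing term; `bc/GammaHodgeSector_probe_CtoS_exact.lean`:
  `exact?` alone with the reduction files in scope, rc 1 "`exact?` could not close the goal") FAIL, as
  they must: the crux is a proper SECTOR (Beta products of Hodge type) of Conjecture 1.
* §2 THE TWO ROADS. Road A (relator compiler): `BetaCancellation → GapSectorBeyondTwelve → C`, and
  given `BetaCancellation` the crux IS its residual (`road_A_iff`); the residual is NECESSARY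
  unconditionally (`residual_necessary`). Road B (root extraction): `PositiveCancellation → C` ALONE
  (`road_B`), and `PositiveCancellation` (stmt-5621) is EQUIVALENT to cancellation by every class of
  non-zero value in `P = FormalRep ⧸ relations` (`road_B_iff_cancellation`) and implies BOTH open
  cancellation cruxes `BetaCancellation` (stmt-13633) and `KZ.PiCancellation` (shape of stmt-0540)
  (`road_B_strength`); it is summit-implied (`road_B_of_summit`), so it admits no kill short of `¬S`.
* §3 THE DEEP RESIDUAL IS INHABITED INSIDE THE CRUX AND INSIDE ROAD A's RESIDUAL: the level-33
  da Silva instance (`deep33_of_crux`, `deep33_of_residual`).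
* §4 PIECE PROBES for BC2 (c) (strategist folder `bc/Pieces_probe.lean`, `exact?` with the reduction
  files in scope): `GapSectorBeyondTwelve → C` FAIL, `BetaCancellation → C` FAIL,
  `GammaHodgePairs → C` FAIL, `PositiveCancellation → C` SUCCESS (= `road_B`: a one-piece road, not a
  split), each piece `→ S` FAIL. So the only typed split with ≥ 2 honest pieces and a PROVED assembly is
  road A, `GammaHodgeSector_of_subs` below — whose open pieces are stmt-13633 (≡ stmt-0540, open in
  print) and stmt-14858 (verdict open-problem, no plan): BC2 (d) fails, see the census §5.
-/

noncomputable section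

namespace Summit.KontsevichZagierPeriods.KontsevichZagierPeriods.Cruxes.GammaHodgeSector.StrategistR1

open Literature.NumberTheory.Transcendental
open Literature.NumberTheory.Transcendental.KZ
open Summit.KontsevichZagierPeriods.KontsevichZagierPeriods.Theses.TerasomaMultiplication
  (GammaHodgeSector MultiplicationAccessible BetaCancellation GapSectorBeyondTwelve DasGapTwelve)
open Summit.KontsevichZagierPeriods.KontsevichZagierPeriods.Theses.SelbergAMGM (PositiveCancellation)
open Summit.KontsevichZagierPeriods.GammaHodgeSectorNegative
open Summit.KontsevichZagierPeriods.GammaHodgeSectorKO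

/-! ## §1 Probes: the crux is a consequence-sector of the summit -/

/-- `S → C` (landed, `GammaHodgeSectorNegative.of_summit`): every instance of the crux is an instance
of the two-representation form of Conjecture 1. [cite: KontsevichZagier2001, §1.2 Conjecture 1] -/
theorem summit_implies_crux : KontsevichZagierPeriods → GammaHodgeSector :=
  of_summit

/-- `¬C → ¬S` (landed): a refutation of the crux refutes the summit; no kill short of `¬S` exists.
[folklore] -/
theorem no_cheap_kill : ¬ GammaHodgeSector → ¬ KontsevichZagierPeriods :=
  summit_false_of_not

/-! ## §2 The two roads to the crux (both complete modulo open-in-print principles) -/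

/-- ROAD A (relator compiler; cruxes 3, 6 and Euler reflection PROVED and discharged):
`BetaCancellation → GapSectorBeyondTwelve → GammaHodgeSector`. This IS the typed split
`GammaHodgeSector_of_subs` of §4. [cite: Deligne1982HodgeCycles, Thm. 7.18] -/
theorem road_A : BetaCancellation → GapSectorBeyondTwelve → GammaHodgeSector :=
  gammaHodgeSector_of_betaCancellation_of_gap

/-- Given `BetaCancellation`, the crux IS its residual. [cite: Deligne1982HodgeCycles, Thm. 7.18] -/
theorem road_A_iff (hB : BetaCancellation) : GammaHodgeSector ↔ GapSectorBeyondTwelve :=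
  gammaHodgeSector_iff_gapSectorBeyondTwelve hB

/-- The residual is NECESSARY, unconditionally (one-line restriction). [folklore] -/
theorem residual_necessary : GammaHodgeSector → GapSectorBeyondTwelve :=
  Summit.KontsevichZagierPeriods.TerasomaMultiplication.GapSectorBeyondTwelve.of_gammaHodgeSector

/-- ROAD B (root extraction): SelbergAMGM's torsion killing (stmt-5621) ALONE gives the crux.
[cite: Deligne1982HodgeCycles, Thm. 7.18] -/
theorem road_B : PositiveCancellation → GammaHodgeSector :=
  gammaHodgeSector_of_positiveCancellation_alone

/-- Road B also settles road A's residual. [folklore] -/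
theorem road_B_residual : PositiveCancellation → GapSectorBeyondTwelve :=
  gapSectorBeyondTwelve_of_positiveCancellation

/-- Road B's input is EQUIVALENT to cancellation by every class of non-zero value in
`P = FormalRep ⧸ relations` (the naive effective formal period ring has no `eval`-regular
zero-divisors). [folklore] -/
theorem road_B_iff_cancellation :
    PositiveCancellation ↔ ∀ c s : FormalRep, eval s ≠ 0 → s * c ∈ relations → c ∈ relations :=
  positiveCancellation_iff_cancellation

/-- Road B's input implies BOTH open cancellation cruxes of the summit: `BetaCancellation`
(stmt-13633) and `KZ.PiCancellation` (the shape of stmt-0540, route AyoubSpecialisation). [folklore] -/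
theorem road_B_strength (h : PositiveCancellation) : BetaCancellation ∧ PiCancellation :=
  ⟨betaCancellation_of_selbergPositiveCancellation h, piCancellation_of_selbergPositiveCancellation h⟩

/-- Road B's input is summit-implied (soundness: `eval` is multiplicative), so it has no refutation
short of `¬S`. [cite: KontsevichZagier2001, §1.2 Conjecture 1] -/
theorem road_B_of_summit (hS : KontsevichZagierPeriods) : PositiveCancellation := by
  rw [road_B_iff_cancellation]
  intro c s hs hsc
  have hK : KZKernelConjecture := KZKernelConjecture.of_kzPeriodConjecture' (core_of_summit hS)
  apply hK
  have h0 : eval (s * c) = 0 := relations_le_ker_eval_holds hsc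
  rw [eval_mul'] at h0
  rcases mul_eq_zero.mp h0 with h | h
  · exact absurd h hs
  · exact h

/-! ## §3 The deep residual is inhabited: the level-33 da Silva instance -/

/-- The crux contains the period relation of da Silva's Hodge class `(7,10,13,19,22,28)/33` on the
Fermat fourfold `X⁴₃₃` (neither quasi-decomposable nor standard; no algebraic cycle known).
[cite: daSilva2021HodgeFermat, Prop. 3.6] -/
theorem deep33_of_crux (h : GammaHodgeSector) :
    Equivalent (cubeRep x33 y33 admissible_fermat33.pos)
      (ballCubeRep 3 Fin.elim0 Fin.elim0 c33 isAlgebraic_c33 admissible_elim0.pos) :=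
  fermat33_of_gammaHodgeSector h

/-- … and so does road A's residual item stmt-14858. [cite: daSilva2021HodgeFermat, Prop. 3.6] -/
theorem deep33_of_residual (h : GapSectorBeyondTwelve) :
    Equivalent (cubeRep x33 y33 admissible_fermat33.pos)
      (ballCubeRep 3 Fin.elim0 Fin.elim0 c33 isAlgebraic_c33 admissible_elim0.pos) :=
  fermat33_of_gapSectorBeyondTwelve h

/-! ## §4 The one typed split with ≥ 2 honest pieces and a proved assembly (BC2 (a)(b)(c) pass, (d) fails) -/

/-- `GammaHodgeSector ⇐ BetaCancellation (stmt-13633) ∧ GapSectorBeyondTwelve (stmt-14858)`, assembly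
PROVED (= `road_A`; both hypotheses consumed). Piece probes: `13633 → C` FAIL, `14858 → C` FAIL,
`13633 → S` FAIL, `14858 → S` FAIL (strategist folder `bc/Pieces_probe.lean`). NOT filed with
`route edit --split`: piece 14858 carries verdict `open-problem` with no registered skeleton or live
line (its content from level 35 on is the naive realisation of motivated, not-known-algebraic Fermat
classes), and piece 13633 is `≡ stmt-0540` with its own `no-strategy` census — BC2 (d) "a plan for
both sides" fails. [cite: Deligne1982HodgeCycles, Thm. 7.18] -/
theorem GammaHodgeSector_of_subs : BetaCancellation → GapSectorBeyondTwelve → GammaHodgeSector :=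
  road_A

end Summit.KontsevichZagierPeriods.KontsevichZagierPeriods.Cruxes.GammaHodgeSector.StrategistR1

end
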